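import Mathlib
import Summits.NavierStokesRegularity.FluidComputer.TransportGalerkinOneSided
import HarnessLib

/-!
# The transport Galerkin model: the field is Lipschitz from the `H²`-level of the scaled box into `E` (instab g17, cell `ns-blowup`, 2026-08-27)

HONEST FRAMING (human ruling D-0035): nothing here is a claim about Navier–Stokes blow-up.
WHAT THIS IS NOT: not NS evidence — the estimate half of condition (C1) for the model instance
«(β2)» of the R-β emergence chain (`HOME/instab/BETA2-SPEC.md` §4): on the set `W = box ρ π P` of
`TransportGalerkinDefs` (radii with `∑_l ⟨l⟩ρ_l < ∞` and `∑_k ⟨k⟩⁴ρ_k² < ∞`), the field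
`F = nsField ν Uv π P` takes its defining values (`coe_nsField_of_mem_box`) and satisfies
`‖F x − F y‖² ≤ L² · ‖⇑x − ⇑y‖₂²` (`norm_nsField_sub_sq_le`) — the hypothesis `hLip` of
`GalerkinLatticeContinuity.continuousOn_of_lipschitz_level` with `t = 2`, i.e. `F` is Lipschitz from
the `H⁴` norm of the unscaled coefficients into the `H²` norm (the Laplacian costs two levels, the
transport terms one; part I's first-slot bound and Warner 6.18 (i) `Lattice.eNorm_conv_le`).

* §1 linearity of scalar convolutions under bounded symbols and summable targets (the box elements
  are NOT rapidly decreasing, so `Lattice.conv_sub`/`sub_conv` do not apply verbatim);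
* §2 `H²`-level bounds for the three building blocks (Laplacian, transport with a summable symbol,
  transport in the first slot);
* §3 box bookkeeping (`H⁴` finiteness, summable derivative norms, bounded components) and the
  identities `linCoeff_sub_box`, `bilCoeff_sub_split_box`;
* §4 `coe_nsField_of_mem_box`, `norm_nsField_sub_sq_le`.

Mathlib + the tree files cited; no new definitions.
-/

noncomputable section

namespace Summit.NavierStokesRegularity.FluidComputer.TransportGalerkinLipschitz

open Set Filter Topology Finset
open Literature.Analysis.FunctionSpaces Literature.Analysis.FunctionSpaces.Lattice
open Literature.Analysis.FunctionSpaces.Torus Literature.Analysis.ODE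
open Summit.NavierStokesRegularity.FluidComputer.GalerkinLatticePhaseSpace
open Summit.NavierStokesRegularity.FluidComputer.TransportGalerkin
open Summit.NavierStokesRegularity.FluidComputer.TransportGalerkinBox
open Summit.NavierStokesRegularity.FluidComputer.TransportCommutatorLattice
open Summit.NavierStokesRegularity.FluidComputer.TransportSkewLattice
open Summit.NavierStokesRegularity.FluidComputer.TransportGalerkinRapid
open Summit.NavierStokesRegularity.FluidComputer.TransportGalerkinOneSided
open scoped ENNReal NNReal ComplexConjugate InnerProductSpace

variable {d : Type*} [Fintype d] [DecidableEq d]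
variable {V : Type*} [NormedAddCommGroup V] [InnerProductSpace ℂ V] [CompleteSpace V]

/-! ## §1 Scalar convolutions: linearity under bounded symbols and summable targets -/

section ScalConv

omit [Fintype d] [DecidableEq d] [CompleteSpace V] in
/-- `‖(χ • 1)(m) v‖ = |χ m| ‖v‖`. -/
theorem norm_scal_apply (χ : (d → ℤ) → ℂ) (m : d → ℤ) (v : V) :
    ‖(scal χ : (d → ℤ) → (V →L[ℂ] V)) m v‖ = ‖χ m‖ * ‖v‖ := by
  rw [scal_apply, show ((χ m • (1 : V →L[ℂ] V)) v) = χ m • v from rfl, norm_smul]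

omit [Fintype d] [DecidableEq d] in
/-- The convolution sums of a bounded scalar symbol against a target with summable norms converge. -/
theorem summable_scal_conv_term {χ : (d → ℤ) → ℂ} {M : ℝ} (hχ : ∀ p, ‖χ p‖ ≤ M)
    {c : (d → ℤ) → V} (hc : Summable fun l => ‖c l‖) (k : d → ℤ) :
    Summable fun l => (scal χ : (d → ℤ) → (V →L[ℂ] V)) (k - l) (c l) :=
  Summable.of_norm_bounded (hc.mul_left M) fun l => by
    rw [norm_scal_apply]
    exact mul_le_mul_of_nonneg_right (hχ _) (norm_nonneg _)

omit [Fintype d] [DecidableEq d] in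
/-- `χ ⋆ (c − c') = χ ⋆ c − χ ⋆ c'` for a bounded scalar symbol and targets with summable norms. -/
theorem conv_scal_sub_of_bounded {χ : (d → ℤ) → ℂ} {M : ℝ} (hχ : ∀ p, ‖χ p‖ ≤ M)
    {c c' : (d → ℤ) → V} (hc : Summable fun l => ‖c l‖) (hc' : Summable fun l => ‖c' l‖) :
    conv (scal χ : (d → ℤ) → (V →L[ℂ] V)) (c - c') = conv (scal χ) c - conv (scal χ) c' := by
  funext k
  simp only [conv_apply, Pi.sub_apply, map_sub]
  exact (summable_scal_conv_term hχ hc k).tsum_sub (summable_scal_conv_term hχ hc' k)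

omit [Fintype d] [DecidableEq d] in
/-- `(χ − ψ) ⋆ c = χ ⋆ c − ψ ⋆ c` for bounded scalar symbols and a target with summable norms. -/
theorem sub_conv_scal_of_bounded {χ ψ : (d → ℤ) → ℂ} {M M' : ℝ} (hχ : ∀ p, ‖χ p‖ ≤ M)
    (hψ : ∀ p, ‖ψ p‖ ≤ M') {c : (d → ℤ) → V} (hc : Summable fun l => ‖c l‖) :
    conv (scal (χ - ψ) : (d → ℤ) → (V →L[ℂ] V)) c = conv (scal χ) c - conv (scal ψ) c := by
  funext k
  rw [Pi.sub_apply, conv_apply, conv_apply, conv_apply,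
    ← (summable_scal_conv_term hχ hc k).tsum_sub (summable_scal_conv_term hψ hc k)]
  refine tsum_congr fun l => ?_
  rw [scal_sub, Pi.sub_apply]
  rfl

end ScalConv

/-! ## §2 `H²`-level bounds for the building blocks -/

section Blocks

omit [DecidableEq d] [InnerProductSpace ℂ V] [CompleteSpace V] in
/-- `‖−c‖_s = ‖c‖_s`. -/
theorem eNorm_neg' [NormedSpace ℂ V] (s : ℝ) (c : (d → ℤ) → V) : eNorm s (-c) = eNorm s c := by
  rw [eNorm, eNormSq_neg, eNorm]

omit [DecidableEq d] [CompleteSpace V] in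
/-- **The Laplacian costs two levels**: `‖∑_j ∂_j∂_j w‖₂ ≤ card d · (2π)² · ‖w‖₄`. -/
theorem eNorm_two_laplacian_le (w : (d → ℤ) → V) :
    eNorm 2 (∑ j, freqDeriv j (freqDeriv j w)) ≤
      (Fintype.card d : ℝ≥0∞) * (ENNReal.ofReal (2 * Real.pi) * ENNReal.ofReal (2 * Real.pi)) *
        eNorm 4 w := by
  have hj : ∀ j, eNorm 2 (freqDeriv j (freqDeriv j w)) ≤
      ENNReal.ofReal (2 * Real.pi) * ENNReal.ofReal (2 * Real.pi) * eNorm 4 w := fun j => by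
    calc eNorm 2 (freqDeriv j (freqDeriv j w))
        ≤ ENNReal.ofReal (2 * Real.pi) * eNorm (2 + 1) (freqDeriv j w) := eNorm_freqDeriv_le 2 j _
      _ ≤ ENNReal.ofReal (2 * Real.pi) * (ENNReal.ofReal (2 * Real.pi) * eNorm (2 + 1 + 1) w) := by
          gcongr; exact eNorm_freqDeriv_le (2 + 1) j w
      _ = ENNReal.ofReal (2 * Real.pi) * ENNReal.ofReal (2 * Real.pi) * eNorm 4 w := by
          rw [mul_assoc]; norm_num
  calc eNorm 2 (∑ j, freqDeriv j (freqDeriv j w))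
      ≤ ∑ j, eNorm 2 (freqDeriv j (freqDeriv j w)) := eNorm_sum_le 2 _ _
    _ ≤ ∑ _j : d, ENNReal.ofReal (2 * Real.pi) * ENNReal.ofReal (2 * Real.pi) * eNorm 4 w :=
        Finset.sum_le_sum fun j _ => hj j
    _ = _ := by rw [Finset.sum_const, Finset.card_univ, nsmul_eq_mul]; ring

omit [DecidableEq d] [CompleteSpace V] in
/-- **Transport with a weighted-`ℓ¹` symbol costs one level** (Warner 6.18 (i)):
`‖∑_j y_j ⋆ ∂_j w‖₂ ≤ (∑_j 2^{|2|/2} A_{|2|}(scal y_j)) · 2π · ‖w‖₃`. -/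
theorem eNorm_two_transport_symb_le (y : d → (d → ℤ) → ℂ) (w : (d → ℤ) → V) :
    eNorm 2 (∑ j, conv (scal (y j)) (freqDeriv j w)) ≤
      (∑ j, ENNReal.ofReal ((2 : ℝ) ^ (|(2 : ℝ)| / 2)) * symbNorm |(2 : ℝ)| (scal (y j) : (d → ℤ) → (V →L[ℂ] V))) *
        (ENNReal.ofReal (2 * Real.pi) * eNorm 3 w) := by
  have hj : ∀ j, eNorm 2 (conv (scal (y j) : (d → ℤ) → (V →L[ℂ] V)) (freqDeriv j w)) ≤
      ENNReal.ofReal ((2 : ℝ) ^ (|(2 : ℝ)| / 2)) * symbNorm |(2 : ℝ)| (scal (y j) : (d → ℤ) → (V →L[ℂ] V)) *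
        (ENNReal.ofReal (2 * Real.pi) * eNorm 3 w) := fun j => by
    calc eNorm 2 (conv (scal (y j) : (d → ℤ) → (V →L[ℂ] V)) (freqDeriv j w))
        ≤ ENNReal.ofReal ((2 : ℝ) ^ (|(2 : ℝ)| / 2)) * symbNorm |(2 : ℝ)| (scal (y j) : (d → ℤ) → (V →L[ℂ] V)) *
            eNorm 2 (freqDeriv j w) := eNorm_conv_le 2 _ _
      _ ≤ _ := by
          gcongr
          have h := eNorm_freqDeriv_le 2 j w
          norm_num at h ⊢
          exact h
  calc eNorm 2 (∑ j, conv (scal (y j)) (freqDeriv j w))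
      ≤ ∑ j, eNorm 2 (conv (scal (y j) : (d → ℤ) → (V →L[ℂ] V)) (freqDeriv j w)) := eNorm_sum_le 2 _ _
    _ ≤ ∑ j, ENNReal.ofReal ((2 : ℝ) ^ (|(2 : ℝ)| / 2)) * symbNorm |(2 : ℝ)| (scal (y j) : (d → ℤ) → (V →L[ℂ] V)) *
        (ENNReal.ofReal (2 * Real.pi) * eNorm 3 w) := Finset.sum_le_sum fun j _ => hj j
    _ = _ := by rw [Finset.sum_mul]

omit [DecidableEq d] [InnerProductSpace ℂ V] [CompleteSpace V] in
/-- **Transport in the first slot** (part I, square-root form): with `|y_j(p)| ≤ ‖c p‖`,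
`‖∑_j y_j ⋆ ∂_j x‖₂ ≤ 2·(card d·2π)·A₃(x)·‖c‖₂`. -/
theorem eNorm_two_transport_first_le [NormedSpace ℂ V] {E' : Type*} [NormedAddCommGroup E']
    (y : d → (d → ℤ) → ℂ) (c : (d → ℤ) → E') (hyc : ∀ j p, ‖y j p‖ ≤ ‖c p‖) (x : (d → ℤ) → V) :
    eNorm 2 (∑ j, conv (scal (y j)) (freqDeriv j x)) ≤
      2 * ((Fintype.card d : ℝ≥0∞) * ENNReal.ofReal (2 * Real.pi)) *
        (∑' l, ENNReal.ofReal (sobolevWeight 3 l) * ‖x l‖ₑ) * eNorm 2 c := by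
  have hsq := eNormSq_two_transport_le y c hyc x
  have h4 : (4 : ℝ≥0∞) = 2 ^ 2 := by norm_num
  rw [h4, ← mul_pow, ← mul_pow, ← eNorm_pow_two, ← eNorm_pow_two 2 c, ← mul_pow] at hsq
  exact (ENNReal.pow_le_pow_left_iff two_ne_zero).1 hsq

end Blocks

/-! ## §3 Box bookkeeping and the coefficient identities on the box -/

section BoxFacts

variable {ρ : (d → ℤ) → ℝ} {ν : ℝ} {Uv : (d → ℤ) → V} {π : d → (V →L[ℂ] ℂ)} {P : (d → ℤ) → (V →L[ℂ] V)}

omit [DecidableEq d] [InnerProductSpace ℂ V] [CompleteSpace V] in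
/-- A single radius is below `R₁ = ∑_l ⟨l⟩ρ_l`. -/
theorem rho_le_tsum (hρ0 : ∀ k, 0 ≤ ρ k) (hρ1 : Summable fun k => sobolevWeight 1 k * ρ k)
    (p : d → ℤ) : ρ p ≤ ∑' l, sobolevWeight 1 l * ρ l :=
  (le_mul_of_one_le_left (hρ0 p) (one_le_sobolevWeight zero_le_one p)).trans
    (hρ1.le_tsum p fun l _ => mul_nonneg (sobolevWeight_pos 1 l).le (hρ0 l))

omit [DecidableEq d] [CompleteSpace V] in
/-- Components of an unscaled box element are bounded by `R₁`. -/
theorem norm_comp_unscale_le (hρ0 : ∀ k, 0 ≤ ρ k) (hρ1 : Summable fun k => sobolevWeight 1 k * ρ k)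
    (hπ : ∀ j, ‖π j‖ ≤ 1) {x : lp (fun _ : (d → ℤ) => V) 2} (hx : x ∈ box ρ π P) (j : d) (p : d → ℤ) :
    ‖(fun p => π j (wmul (-2) (⇑x) p)) p‖ ≤ ∑' l, sobolevWeight 1 l * ρ l := by
  refine ((norm_comp_le π hπ _ j p).trans (norm_unscale_apply_le hx p)).trans ?_
  calc sobolevWeight (-2) p * ρ p ≤ 1 * ρ p :=
        mul_le_mul_of_nonneg_right (sobolevWeight_le_one (by norm_num) p) (hρ0 p)
    _ ≤ _ := by rw [one_mul]; exact rho_le_tsum hρ0 hρ1 p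

omit [DecidableEq d] [CompleteSpace V] in
/-- Derivatives of an unscaled box element have summable norms: `‖∂_j u (l)‖ ≤ 2π ⟨l⟩ ρ_l`. -/
theorem summable_norm_freqDeriv_unscale (hρ0 : ∀ k, 0 ≤ ρ k)
    (hρ1 : Summable fun k => sobolevWeight 1 k * ρ k) {x : lp (fun _ : (d → ℤ) => V) 2}
    (hx : x ∈ box ρ π P) (j : d) : Summable fun l => ‖freqDeriv j (wmul (-2) (⇑x)) l‖ := by
  refine Summable.of_nonneg_of_le (fun l => norm_nonneg _) (fun l => ?_) (hρ1.mul_left (2 * Real.pi))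
  rw [norm_freqDeriv_apply]
  have h1 : |(l j : ℝ)| ≤ sobolevWeight 1 l := abs_apply_le_sobolevWeight_one l j
  have h2 : ‖wmul (-2) (⇑x) l‖ ≤ ρ l := (norm_unscale_apply_le hx l).trans
    ((mul_le_mul_of_nonneg_right (sobolevWeight_le_one (by norm_num) l) (hρ0 l)).trans (by rw [one_mul]))
  calc 2 * Real.pi * |(l j : ℝ)| * ‖wmul (-2) (⇑x) l‖
      ≤ 2 * Real.pi * sobolevWeight 1 l * ρ l :=
        mul_le_mul (mul_le_mul_of_nonneg_left h1 (by positivity)) h2 (norm_nonneg _)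
          (by positivity [sobolevWeight_pos 1 l])
    _ = 2 * Real.pi * (sobolevWeight 1 l * ρ l) := by ring

omit [DecidableEq d] [CompleteSpace V] in
/-- **Box elements are `H⁴` after unscaling** (`H²` as scaled families): `‖⇑x‖₂² ≤ ∑_k (⟨k⟩²ρ_k)²`. -/
theorem eNormSq_two_coe_le (hρ2 : Summable fun k => (sobolevWeight 2 k * ρ k) ^ 2)
    {x : lp (fun _ : (d → ℤ) => V) 2} (hx : x ∈ box ρ π P) :
    eNormSq 2 (⇑x) ≤ ENNReal.ofReal (∑' k, (sobolevWeight 2 k * ρ k) ^ 2) := by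
  have hterm : ∀ k, ENNReal.ofReal (sobolevWeight 2 k ^ 2) * ‖(⇑x) k‖ₑ ^ 2 ≤
      ENNReal.ofReal ((sobolevWeight 2 k * ρ k) ^ 2) := fun k => by
    rw [← ofReal_norm, ← ENNReal.ofReal_pow (norm_nonneg _), ← ENNReal.ofReal_mul (sq_nonneg _)]
    refine ENNReal.ofReal_le_ofReal ?_
    rw [mul_pow]
    exact mul_le_mul_of_nonneg_left (pow_le_pow_left₀ (norm_nonneg _) (hx.1 k) 2) (sq_nonneg _)
  calc eNormSq 2 (⇑x) ≤ ∑' k, ENNReal.ofReal ((sobolevWeight 2 k * ρ k) ^ 2) := ENNReal.tsum_le_tsum hterm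
    _ = ENNReal.ofReal (∑' k, (sobolevWeight 2 k * ρ k) ^ 2) :=
        (ENNReal.ofReal_tsum_of_nonneg (fun k => sq_nonneg _) hρ2).symm

omit [DecidableEq d] [CompleteSpace V] in
/-- Unscaled box elements lie in `H⁴`. -/
theorem eNormSq_four_unscale_lt_top
    (hρ2 : Summable fun k => (sobolevWeight 2 k * ρ k) ^ 2) {x : lp (fun _ : (d → ℤ) => V) 2}
    (hx : x ∈ box ρ π P) : eNormSq 4 (wmul (-2) (⇑x)) < ∞ := by
  rw [show (4 : ℝ) = 2 + 2 by norm_num, ← eNormSq_wmul, wmul_two_wmul_neg_two]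
  exact (eNormSq_two_coe_le hρ2 hx).trans_lt ENNReal.ofReal_lt_top

omit [DecidableEq d] [CompleteSpace V] in
/-- Unscaled box elements are tempered. -/
theorem tempered_unscale (hρ2 : Summable fun k => (sobolevWeight 2 k * ρ k) ^ 2)
    {x : lp (fun _ : (d → ℤ) => V) 2} (hx : x ∈ box ρ π P) : Tempered (wmul (-2) (⇑x)) :=
  ⟨4, eNormSq_four_unscale_lt_top hρ2 hx⟩

omit [DecidableEq d] in
/-- **Linearity of `linCoeff` across two box elements** (third term by the bounded/summable
convolution lemma of §1, the host's derivative having summable norms). -/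
theorem linCoeff_sub_box (hUv : RapidDecay Uv) (hπ : ∀ j, ‖π j‖ ≤ 1) (hρ0 : ∀ k, 0 ≤ ρ k)
    (hρ1 : Summable fun k => sobolevWeight 1 k * ρ k) (hρ2 : Summable fun k => (sobolevWeight 2 k * ρ k) ^ 2)
    {x y : lp (fun _ : (d → ℤ) => V) 2} (hx : x ∈ box ρ π P) (hy : y ∈ box ρ π P) :
    linCoeff ν Uv π (wmul (-2) ⇑x - wmul (-2) ⇑y) =
      linCoeff ν Uv π (wmul (-2) ⇑x) - linCoeff ν Uv π (wmul (-2) ⇑y) := by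
  set u := wmul (-2) (⇑x) with hu
  set v := wmul (-2) (⇑y) with hv
  simp only [linCoeff_eq]
  have h1 : (∑ j, freqDeriv j (freqDeriv j (u - v))) =
      (∑ j, freqDeriv j (freqDeriv j u)) - ∑ j, freqDeriv j (freqDeriv j v) := by
    rw [← Finset.sum_sub_distrib]
    exact Finset.sum_congr rfl fun j _ => by rw [freqDeriv_sub, freqDeriv_sub]
  have h2 : (∑ j, conv (scal (fun p => π j (Uv p)) : (d → ℤ) → (V →L[ℂ] V)) (freqDeriv j (u - v))) =
      (∑ j, conv (scal (fun p => π j (Uv p))) (freqDeriv j u)) -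
        ∑ j, conv (scal (fun p => π j (Uv p))) (freqDeriv j v) := by
    rw [← Finset.sum_sub_distrib]
    refine Finset.sum_congr rfl fun j _ => ?_
    rw [freqDeriv_sub, conv_sub (hUv.comp_apply (π j)).scal
      ((tempered_unscale hρ2 hx).freqDeriv j) ((tempered_unscale hρ2 hy).freqDeriv j)]
  have h3 : (∑ j, conv (scal (fun p => π j ((u - v) p)) : (d → ℤ) → (V →L[ℂ] V)) (freqDeriv j Uv)) =
      (∑ j, conv (scal (fun p => π j (u p))) (freqDeriv j Uv)) -
        ∑ j, conv (scal (fun p => π j (v p))) (freqDeriv j Uv) := by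
    rw [← Finset.sum_sub_distrib]
    refine Finset.sum_congr rfl fun j _ => ?_
    rw [comp_sub, sub_conv_scal_of_bounded (norm_comp_unscale_le hρ0 hρ1 hπ hx j)
      (norm_comp_unscale_le hρ0 hρ1 hπ hy j) (hUv.freqDeriv' j).summable_norm]
  rw [h1, h2, h3, smul_sub]
  abel

omit [DecidableEq d] in
/-- **The bilinear split across two box elements**: `B(u,u) − B(v,v) = B(u − v, u) + B(v, u − v)`. -/
theorem bilCoeff_sub_split_box (hπ : ∀ j, ‖π j‖ ≤ 1) (hρ0 : ∀ k, 0 ≤ ρ k)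
    (hρ1 : Summable fun k => sobolevWeight 1 k * ρ k)
    {x y : lp (fun _ : (d → ℤ) => V) 2} (hx : x ∈ box ρ π P) (hy : y ∈ box ρ π P) :
    bilCoeff π (wmul (-2) ⇑x) (wmul (-2) ⇑x) - bilCoeff π (wmul (-2) ⇑y) (wmul (-2) ⇑y) =
      bilCoeff π (wmul (-2) ⇑x - wmul (-2) ⇑y) (wmul (-2) ⇑x) +
        bilCoeff π (wmul (-2) ⇑y) (wmul (-2) ⇑x - wmul (-2) ⇑y) := by
  set u := wmul (-2) (⇑x) with hu
  set v := wmul (-2) (⇑y) with hv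
  simp only [bilCoeff_eq]
  have h1 : ∀ j, conv (scal (fun p => π j ((u - v) p)) : (d → ℤ) → (V →L[ℂ] V)) (freqDeriv j u) =
      conv (scal (fun p => π j (u p))) (freqDeriv j u) - conv (scal (fun p => π j (v p))) (freqDeriv j u) :=
    fun j => by
      rw [comp_sub, sub_conv_scal_of_bounded (norm_comp_unscale_le hρ0 hρ1 hπ hx j)
        (norm_comp_unscale_le hρ0 hρ1 hπ hy j) (summable_norm_freqDeriv_unscale hρ0 hρ1 hx j)]
  have h2 : ∀ j, conv (scal (fun p => π j (v p)) : (d → ℤ) → (V →L[ℂ] V)) (freqDeriv j (u - v)) =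
      conv (scal (fun p => π j (v p))) (freqDeriv j u) - conv (scal (fun p => π j (v p))) (freqDeriv j v) :=
    fun j => by
      rw [freqDeriv_sub, conv_scal_sub_of_bounded (norm_comp_unscale_le hρ0 hρ1 hπ hy j)
        (summable_norm_freqDeriv_unscale hρ0 hρ1 hx j) (summable_norm_freqDeriv_unscale hρ0 hρ1 hy j)]
  simp only [h1, h2, Finset.sum_sub_distrib]
  abel

end BoxFacts

end Summit.NavierStokesRegularity.FluidComputer.TransportGalerkinLipschitz

end
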